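import Summits.Ventures.HSemireg.Pad4TowerPermWindow
import Summits.Ventures.HSemireg.Pad4TowerFCCoreSeam

/-!
# HSemireg ∕ pad-4 tower on 𝔅(μ₄) — A CONJUGATE PAIR IS CLASS-CLEAN FOR FREE (req-80 BLOCK E2 «extremal», typed note)

HONEST FRAMING. Evidence-level typed file of the computation cell `pub-hsemireg` (S4-PUSH, H2 door PAD-4), written by the E2
«extremal» seat `plan-lens-HodgeAV-extremal-g0` (director-hodge g20 R19.171 ∕ R19.176, block E2) on the line of record
stmt-HodgeConjecture-18881 (`Cruxes/BlochSeedDiscOne/Lines/birth.lean` 814a6a70c14e831a, stub `stub_rung_pad4_seedAt`; screen (H1) =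
the class condition (A1) = `ClassScreen`). It TYPES mechanism M1 («conjugate pair») of the seat's memo VERTEX-STRUCTURE-extremal-g0.md
v1.2 (tree `Cruxes/BlochSeedDiscOne/VERTEX-STRUCTURE-extremal-g0.md` 739a837c3924, §3 V1∕M1, §4a pair census): «a realisable odd fully
charged orbit `c` and its complex conjugate `c̄`, put on opposite levels with EQUAL loads, form a class-clean design; all of its content is
static». Here that sentence is a KERNEL THEOREM about every cell whatsoever — no oddness, no full charge, no diamond, no `h`.

CONTENT (all PROVED; no `sorry`; axioms standard).
* §1 `conjPt`, **`MCell.conj`** (`β_f ↦ β̄_f` on every factor), `swapE` ∕ `swapEW` (the letter swap `e ↔ ē` of the frame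
  `(1, h, h', e, ē, pt)`), `bphi_conjPt`, **`MCell.ch_conj`: `ch(Z̄)(w) = ch(Z)(w^{e↔ē})`**, `MCell.conj_perm`, `swapEW_permW`, `swapEW_eWord`.
* §2 **`MCell.rot k = Δ^k`** (`β_f ↦ i^k β_f` on every factor) and `MCell.ch_rot : ch(Δ^k Z)(w) = twistW(w)^k · ch(Z)(w)`;
  `rot4_sum`: `Σ_{k<4} (iⁿ)^k = 4·[4 ∣ n]`.
* §3 `invList` (the ten involutions of `S₄`) and **`swapEW_eq_permW`**: on every word `w ∉ {eeee, ēēēē}` with `n_e ≡ n_ē (mod 4)` the swap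
  `e ↔ ē` acts as a PERMUTATION of the four slots (kernel `decide` over the `6⁴` words); `sum_perm_inv`, `sum_perm_mulLeft` (reindexing `S₄`-sums).
* §4 **`conjPairCh Z := Σ_{σ ∈ S₄} Σ_{k<4} [ch(Δ^k σZ) − ch(Δ^k σZ̄)]`** — the class function of the `G₁`-symmetrised difference «the orbit
  of `Z` on one level minus the orbit of `Z̄` on the other, equal unit loads» (`G₁ = ⟨Δ⟩ × S₄`; the group sum is `|Stab_{G₁}(Z)|` times the
  orbit sum, and `ClassScreen` is homogeneous, so the statement covers the orbit design); `conjPairCh_apply` (word by word: the rotation factor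
  `Σ_k twistW(w)^k` times the `S₄`-sum of `ch Z(σ·w) − ch Z(σ·w^{e↔ē})`); **`conjPairCh_eq_zero`: EVERY word other than `eeee`, `ēēēē` is
  killed** (the `⟨Δ⟩`-average kills `n_e ≢ n_ē (mod 4)`; on the rest `w^{e↔ē}` is a permutation of `w` and the `S₄`-sums of `Z` and `Z̄` agree);
  **`classScreen_conjPairCh`: THE CONJUGATE PAIR PASSES THE CLASS SCREEN (A1)** for every cell `Z`; `conjPairCh_eWord`: its `μ`-word is
  `96 · (ch Z eeee − ch Z ēēēē)` (`= 96 (Π_f β_f − Π_f β̄_f)`; with `Pad4TowerFCCoreSeam`'s `MCell.ch_ebarWord_eq_star` this is `192 i · Im Π_f β_f`,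
  non-zero iff `Π_f β_f ∉ ℝ` — not restated here).
* §5 (v2) **CONJUGATION IS A SYMMETRY OF THE WHOLE CLASS SIDE**: `eFree_swapEW_iff`, `wdeg_swapEW`, `swapEW_of_eFree`, `classScreen_comp_swapEW`
  ((A1) is invariant under `T ↦ T ∘ (e ↔ ē)`); **`MConfig.conj`** (both sides conjugated cellwise, multiplicities carried along) with
  `MConfig.wch_conj : wch(C̄, m̄)(w) = wch(C, m)(w^{e↔ē})`, **`MConfig.classScreen_conj`** (a clean weighted design stays clean),
  `MConfig.wch_conj_of_eFree` (every e-free coefficient — ranks, `ĥ_k`-coordinates — unchanged), `MConfig.conj_lower_card` ∕ `_upper_card`,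
  and **`MConfig.wch_conj_eWord : wch(C̄)(eeee) = star wch(C)(eeee)`** (`Im μ ↦ −Im μ`, `Re μ` fixed). With the memo's CHECKED static half
  (v1.5 §3e: the three residual CNFs of record are invariant, clause set for clause set, under the induced permutation of orbit variables) this
  is the symmetry reduction handed to block C: «max Im μ» and «min Im μ» over clean realisable designs are ONE problem up to conjugation
  (the `im−` run of an enumerator is the conjugate of its `im+` run — a free replication check), whereas `Re μ > 0` and `Re μ < 0` are NOT
  exchanged by it (and indeed behave differently carrier-wise at `h = 16`).
READING (what this is evidence FOR, in the memo's words). The extremal analysis found that the LP optimum of `Im μ` over class-clean designs is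
carried by odd fully charged orbits and that the realisable positive designs are either CONJUGATE PAIRS (M1) or two-carrier STARS (M2); this file
says the M1 half needs no class bookkeeping at all: a pair is (A1)-clean identically in the letters, so whether a pair is a design is a purely
STATIC question (joint realisability of the two orbits — the memo's pair census: LINE-14 three letter types, LINE-16 twenty-three, BAND-4@12
none). A prediction ≠ a certificate ≠ a design ≠ a SOURCE ≠ a SEED.
WHAT IS NOT HERE ∕ NOT IN LEAN. No static rule, no SAT verdict, no (H1) value of record (BLOCK A ∕ D words only), no statement about WHICH pairs
are realisable, nothing about stars (M2); the identification of the frame with `H^{ev}(S⁴)` stays the cell's pencil modelling sentence. No variety,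
sheaf, σ, seed or abelian variety; NOTHING HERE SAYS THAT HC ∕ HC_CM ∕ HC_AV ∕ W₆ ∕ HC_Kum4Type HOLDS OR FAILS, and nothing here is a rung of
18881 ∕ H2. No `instance`, no notation, no named fact, 0 `sorry`.
SOURCES (sha16 ∕ bus). Tree: `Pad4TowerPermWindow.lean` (`MCell.perm`, `MCell.ch_perm`, `permW`, `permW_mul`, `permW_eWord`),
`Pad4TowerDeltaWindow.lean` (`MCell.delta`, `twistW`, `MCell.ch_delta`, `twistW_eWord`), `Pad4TowerPsiSubA1.lean` (`bphi`, `MCell.ch`),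
`Pad4TowerClassScreen.lean` (`ClassScreen`, `EFree`, `wdeg`, `ldeg`, `eWord`, `ebarWord`, `not_eFree_eWord`), `Pad4TowerFCCoreSeam.lean` (`MConfig.wch_ebarWord_eq_star`), `Pad4TowerCrossPhase.lean` (`MConfig`); memo VERTEX-STRUCTURE-extremal-g0.md v1.2
2982e02bc934caa0 (HOME `pub/ideators/plan-lens-HodgeAV-extremal/memo-01/`); pub-hsemireg INBOX l.5919 (E2 first deliverable), l.6019, l.6042;
idea-crit-hsem-3 memo-h3-06 abee0f3c814db0fc (E2 PASS-WITH-PRICE); director-hodge g20 R19.216.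
-/

namespace Summit.Ventures.HSemireg.Pad4Tower

open Finset

/-! ## §1 Conjugation of factor points and cells: it swaps the letters `e ↔ ē` -/

/-- complex conjugation of a factor point: `(α, Re β, Im β) ↦ (α, Re β, −Im β)` (`β ↦ β̄`, `α` and `pt = α² − |β|²` fixed). -/
def conjPt (x : BPoint) : BPoint := (x.1, x.2.1, -x.2.2)

/-- conjugation of a cell, factor by factor (`Z̄`). -/
def MCell.conj (Z : MCell) : MCell := fun f => conjPt (Z f)

/-- the letter swap `e ↔ ē` (indices `3 ↔ 4` of the frame `(1, h, h', e, ē, pt)`). -/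
def swapE : Fin 6 → Fin 6 := ![0, 1, 2, 4, 3, 5]

/-- the word with `e` and `ē` exchanged in every slot (`w^{e↔ē}`). -/
def swapEW (w : CWord) : CWord := fun f => swapE (w f)

theorem swapEW_apply (w : CWord) (f : Fin 4) : swapEW w f = swapE (w f) := rfl

/-- conjugation permutes the letter vector: `φ(x̄)_l = φ(x)_{l^{e↔ē}}`. -/
theorem bphi_conjPt (x : BPoint) (l : Fin 6) : bphi (conjPt x) l = bphi x (swapE l) := by
  fin_cases l
  · simp [bphi, conjPt, phiVec, swapE]
  · simp [bphi, conjPt, phiVec, swapE]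
  · simp [bphi, conjPt, phiVec, swapE]
  · simp [bphi, conjPt, phiVec, swapE]
  · simp [bphi, conjPt, phiVec, swapE]
  · simp [bphi, conjPt, phiVec, swapE]

/-- **`ch(Z̄)(w) = ch(Z)(w^{e↔ē})`.** -/
theorem MCell.ch_conj (Z : MCell) (w : CWord) : Z.conj.ch w = Z.ch (swapEW w) := by
  simp only [MCell.ch, chTensor, MCell.conj, bphi_conjPt, swapEW]

/-- conjugation commutes with the factor permutations. -/
theorem MCell.conj_perm (σ : Equiv.Perm (Fin 4)) (Z : MCell) : Z.conj.perm σ = (Z.perm σ).conj := rfl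

/-- the letter swap commutes with the slot permutations. -/
theorem swapEW_permW (σ : Equiv.Perm (Fin 4)) (w : CWord) : swapEW (permW σ w) = permW σ (swapEW w) := rfl

/-- `eeee^{e↔ē} = ēēēē` and back. -/
theorem swapEW_eWord : swapEW eWord = ebarWord ∧ swapEW ebarWord = eWord := by
  constructor <;> funext f <;> fin_cases f <;> rfl

/-! ## §2 The rotations `Δ^k` and the rotation factor -/

/-- the `k`-th phase rotation `Δ^k` of a cell (`β_f ↦ i^k β_f` on every factor). -/
def MCell.rot (k : ℕ) (Z : MCell) : MCell := MCell.delta^[k] Z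

theorem MCell.rot_zero (Z : MCell) : Z.rot 0 = Z := rfl

theorem MCell.rot_succ (k : ℕ) (Z : MCell) : Z.rot (k + 1) = (Z.rot k).delta :=
  Function.iterate_succ_apply' MCell.delta k Z

/-- **`ch(Δ^k Z)(w) = twistW(w)^k · ch(Z)(w)`** (`twistW(w) = i^{n_e(w) − n_ē(w)}`, `Pad4TowerDeltaWindow.MCell.ch_delta` iterated). -/
theorem MCell.ch_rot (k : ℕ) (Z : MCell) (w : CWord) : (Z.rot k).ch w = twistW w ^ k * Z.ch w := by
  induction k with
  | zero => rw [MCell.rot_zero, pow_zero, one_mul]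
  | succ k ih => rw [MCell.rot_succ, MCell.ch_delta, ih]; ring

/-- the rotation factor: `Σ_{k<4} (iⁿ)^k = 4` if `4 ∣ n`, else `0`. -/
theorem rot4_sum (n : ℕ) : ∑ k ∈ range 4, (gI ^ n) ^ k = if n % 4 = 0 then 4 else 0 := by
  have h4 : gI ^ 4 = 1 := by decide
  have key : gI ^ n = gI ^ (n % 4) := by
    conv_lhs => rw [← Nat.mod_add_div n 4, pow_add, pow_mul, h4, one_pow, mul_one]
  rw [key]
  have h := Nat.mod_lt n (by norm_num : 0 < 4)
  generalize n % 4 = r at h ⊢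
  interval_cases r <;> simp only [Finset.sum_range_succ, Finset.sum_range_zero] <;> decide

/-! ## §3 On the surviving words the letter swap is a slot permutation -/

/-- the ten involutions of `S₄` (identity, six transpositions, three double transpositions). -/
def invList : List (Equiv.Perm (Fin 4)) :=
  [1, Equiv.swap 0 1, Equiv.swap 0 2, Equiv.swap 0 3, Equiv.swap 1 2, Equiv.swap 1 3, Equiv.swap 2 3,
    Equiv.swap 0 1 * Equiv.swap 2 3, Equiv.swap 0 2 * Equiv.swap 1 3, Equiv.swap 0 3 * Equiv.swap 1 2]

/-- letter-level form (kernel, `decide` over the `6⁴` words): if `n_e − n_ē ≡ 0 (mod 4)` (`wtwExp ≡ 0`) and the word is neither `eeee`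
nor `ēēēē`, then `n_e = n_ē ≤ 2` and exchanging `e ↔ ē` is realised by one of the ten involutions of the slots. -/
theorem swapEW_eq_permW_vec : ∀ a b c d : Fin 6, wtwExp ![a, b, c, d] % 4 = 0 → ![a, b, c, d] ≠ eWord →
    ![a, b, c, d] ≠ ebarWord → ∃ τ ∈ invList, swapEW ![a, b, c, d] = permW τ ![a, b, c, d] := by
  decide +kernel

/-- **on every word `w ∉ {eeee, ēēēē}` with `n_e ≡ n_ē (mod 4)`, `w^{e↔ē}` is a permutation of `w`.** -/
theorem swapEW_eq_permW (w : CWord) (h0 : wtwExp w % 4 = 0) (h1 : w ≠ eWord) (h2 : w ≠ ebarWord) :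
    ∃ τ : Equiv.Perm (Fin 4), swapEW w = permW τ w := by
  have hw : w = ![w 0, w 1, w 2, w 3] := by funext f; fin_cases f <;> rfl
  rw [hw] at h0 h1 h2
  rw [hw]
  obtain ⟨τ, -, hτ⟩ := swapEW_eq_permW_vec (w 0) (w 1) (w 2) (w 3) h0 h1 h2
  exact ⟨τ, hτ⟩

/-- reindexing an `S₄`-sum by inversion. -/
theorem sum_perm_inv {M : Type*} [AddCommMonoid M] (H : Equiv.Perm (Fin 4) → M) :
    ∑ σ : Equiv.Perm (Fin 4), H σ⁻¹ = ∑ σ : Equiv.Perm (Fin 4), H σ :=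
  Equiv.sum_comp (Equiv.inv (Equiv.Perm (Fin 4))) H

/-- reindexing an `S₄`-sum by left multiplication. -/
theorem sum_perm_mulLeft {M : Type*} [AddCommMonoid M] (τ : Equiv.Perm (Fin 4)) (H : Equiv.Perm (Fin 4) → M) :
    ∑ σ : Equiv.Perm (Fin 4), H (τ * σ) = ∑ σ : Equiv.Perm (Fin 4), H σ :=
  Equiv.sum_comp (Equiv.mulLeft τ) H

/-! ## §4 The conjugate pair: class-clean identically in the letters -/

/-- **THE CLASS FUNCTION OF THE SYMMETRISED CONJUGATE PAIR on a cell `Z`**: `Σ_{σ ∈ S₄} Σ_{k<4} [ch(Δ^k σZ) − ch(Δ^k σZ̄)]`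
(the `G₁ = ⟨Δ⟩ × S₄` group sum of «`Z` on one level, `Z̄` on the other, equal unit loads»; `MConfig.wch`'s orientation `Σ_N − Σ_P`
with `N ∈ G₁Z`, `P ∈ G₁Z̄`, up to the factor `|Stab_{G₁} Z|`). -/
def conjPairCh (Z : MCell) : CWord → GaussianInt := fun w =>
  ∑ σ : Equiv.Perm (Fin 4), ∑ k ∈ range 4, (((Z.perm σ).rot k).ch w - ((Z.conj.perm σ).rot k).ch w)

/-- word by word: the rotation factor times the `S₄`-sum of `ch Z(σ·w) − ch Z(σ·w^{e↔ē})`. -/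
theorem conjPairCh_apply (Z : MCell) (w : CWord) : conjPairCh Z w =
    (∑ k ∈ range 4, twistW w ^ k) * ∑ σ : Equiv.Perm (Fin 4), (Z.ch (permW σ w) - Z.ch (permW σ (swapEW w))) := by
  have hterm : ∀ (σ : Equiv.Perm (Fin 4)) (k : ℕ), ((Z.perm σ).rot k).ch w - ((Z.conj.perm σ).rot k).ch w =
      twistW w ^ k * (Z.ch (permW σ⁻¹ w) - Z.ch (permW σ⁻¹ (swapEW w))) := fun σ k => by
    rw [MCell.ch_rot, MCell.ch_rot, MCell.conj_perm, MCell.ch_conj, MCell.ch_perm, MCell.ch_perm]; ring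
  unfold conjPairCh
  simp_rw [hterm]
  calc ∑ σ : Equiv.Perm (Fin 4), ∑ k ∈ range 4, twistW w ^ k * (Z.ch (permW σ⁻¹ w) - Z.ch (permW σ⁻¹ (swapEW w)))
      = ∑ σ : Equiv.Perm (Fin 4), (∑ k ∈ range 4, twistW w ^ k) * (Z.ch (permW σ⁻¹ w) - Z.ch (permW σ⁻¹ (swapEW w))) :=
        Finset.sum_congr rfl fun σ _ => (Finset.sum_mul _ _ _).symm
    _ = ∑ σ : Equiv.Perm (Fin 4), (∑ k ∈ range 4, twistW w ^ k) * (Z.ch (permW σ w) - Z.ch (permW σ (swapEW w))) :=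
        sum_perm_inv fun ρ => (∑ k ∈ range 4, twistW w ^ k) * (Z.ch (permW ρ w) - Z.ch (permW ρ (swapEW w)))
    _ = (∑ k ∈ range 4, twistW w ^ k) * ∑ σ : Equiv.Perm (Fin 4), (Z.ch (permW σ w) - Z.ch (permW σ (swapEW w))) :=
        (Finset.mul_sum _ _ _).symm

/-- **EVERY WORD OTHER THAN `eeee`, `ēēēē` IS KILLED** — e-mixed AND e-free words alike. -/
theorem conjPairCh_eq_zero (Z : MCell) (w : CWord) (h1 : w ≠ eWord) (h2 : w ≠ ebarWord) : conjPairCh Z w = 0 := by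
  rw [conjPairCh_apply, twistW, rot4_sum]
  by_cases h0 : wtwExp w % 4 = 0
  · obtain ⟨τ, hτ⟩ := swapEW_eq_permW w h0 h1 h2
    rw [if_pos h0, hτ]
    have hS : ∑ σ : Equiv.Perm (Fin 4), (Z.ch (permW σ w) - Z.ch (permW σ (permW τ w))) = 0 := by
      rw [Finset.sum_sub_distrib, sub_eq_zero]
      simp_rw [← permW_mul]
      exact (sum_perm_mulLeft τ fun ρ => Z.ch (permW ρ w)).symm
    rw [hS, mul_zero]
  · rw [if_neg h0, zero_mul]

/-- **THE CONJUGATE PAIR PASSES THE CLASS SCREEN (A1), for every cell** (memo V1 ∕ M1: «a conjugate pair with equal loads is class-clean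
identically in the letters; all of its content is static»). -/
theorem classScreen_conjPairCh (Z : MCell) : ClassScreen (conjPairCh Z) := by
  have ne : ∀ v : CWord, EFree v → v ≠ eWord ∧ v ≠ ebarWord := fun v hv =>
    ⟨fun h => not_eFree_eWord.1 (h ▸ hv), fun h => not_eFree_eWord.2.1 (h ▸ hv)⟩
  refine ⟨fun w _ hw1 hw2 => conjPairCh_eq_zero Z w hw1 hw2, fun w w' hw hw' _ => ?_⟩
  rw [conjPairCh_eq_zero Z w (ne w hw).1 (ne w hw).2, conjPairCh_eq_zero Z w' (ne w' hw').1 (ne w' hw').2]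

/-- **the μ-word of the pair**: `conjPairCh Z eeee = 96 · (ch Z eeee − ch Z ēēēē)` (`= 96 (Π_f β_f − Π_f β̄_f)`). -/
theorem conjPairCh_eWord (Z : MCell) : conjPairCh Z eWord = 96 * (Z.ch eWord - Z.ch ebarWord) := by
  rw [conjPairCh_apply, twistW_eWord.1]
  simp_rw [swapEW_eWord.1, permW_eWord, permW_ebarWord]
  rw [Finset.sum_const, Finset.card_univ, Fintype.card_perm, Fintype.card_fin, show Nat.factorial 4 = 24 from rfl]
  simp only [one_pow, Finset.sum_const, Finset.card_range, nsmul_eq_mul, Nat.cast_ofNat]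
  ring

/-! ## §5 Conjugation is a symmetry of the whole class side (v2)

`Z ↦ Z̄` (cellwise `conjPt`) transports ANY weighted configuration to one whose weighted class tensor is the old one read
through the letter swap `e ↔ ē`: `wch(C̄, m̄)(w) = wch(C, m)(w^{e↔ē})` (`MConfig.wch_conj`).  Since `e ↔ ē` preserves e-freeness
and degrees and swaps `eeee ↔ ēēēē`, the class screen (A1) is INVARIANT (`MConfig.classScreen_conj`), every e-free coefficient
(ranks, `ĥ_k`-coordinates) is unchanged (`MConfig.wch_conj_of_eFree`), the cell counts are unchanged, and the μ-word is
CONJUGATED: `wch(C̄)(eeee) = star wch(C)(eeee)` (`MConfig.wch_conj_eWord`, via `Pad4TowerFCCoreSeam`'s `wch_ebarWord_eq_star`).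
So on the class side «max Im μ» and «min Im μ» are the same problem up to conjugation while `Re μ` is conjugation-invariant;
the STATIC half of this symmetry (the residual CNFs of record are invariant under the induced permutation of orbit variables)
is a checked computation in the memo (§3e), not a theorem here. -/

theorem swapE_swapE (l : Fin 6) : swapE (swapE l) = l := by fin_cases l <;> rfl

theorem swapEW_swapEW (w : CWord) : swapEW (swapEW w) = w := by
  funext f; simp only [swapEW_apply, swapE_swapE]

theorem swapE_ne_iff (l : Fin 6) : (swapE l ≠ 3 ∧ swapE l ≠ 4) ↔ (l ≠ 3 ∧ l ≠ 4) := by fin_cases l <;> decide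

/-- `e ↔ ē` preserves e-freeness. -/
theorem eFree_swapEW_iff (w : CWord) : EFree (swapEW w) ↔ EFree w := forall_congr' fun f => swapE_ne_iff (w f)

theorem ldeg_swapE (l : Fin 6) : ldeg (swapE l) = ldeg l := by fin_cases l <;> rfl

/-- `e ↔ ē` preserves degrees. -/
theorem wdeg_swapEW (w : CWord) : wdeg (swapEW w) = wdeg w := by
  simp only [wdeg, swapEW_apply, ldeg_swapE]

/-- an e-free word is FIXED by `e ↔ ē`. -/
theorem swapEW_of_eFree {w : CWord} (h : EFree w) : swapEW w = w := by
  funext f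
  have h3 := (h f).1; have h4 := (h f).2
  rw [swapEW_apply]; generalize w f = l at h3 h4
  fin_cases l <;> first | rfl | exact absurd rfl h3 | exact absurd rfl h4

/-- **the class screen is invariant under `e ↔ ē`** (any coefficient type). -/
theorem classScreen_comp_swapEW {R : Type*} [Zero R] {T : CWord → R} (h : ClassScreen T) :
    ClassScreen (fun w => T (swapEW w)) := by
  refine ⟨fun w h1 h2 h3 => h.1 _ ?_ ?_ ?_, fun w w' hw hw' hd => h.2 _ _ ?_ ?_ ?_⟩
  · exact fun hf => h1 ((eFree_swapEW_iff w).1 hf)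
  · intro he; apply h3
    have := congrArg swapEW he; rwa [swapEW_swapEW, swapEW_eWord.1] at this
  · intro he; apply h2
    have := congrArg swapEW he; rwa [swapEW_swapEW, swapEW_eWord.2] at this
  · exact (eFree_swapEW_iff w).2 hw
  · exact (eFree_swapEW_iff w').2 hw'
  · rwa [wdeg_swapEW, wdeg_swapEW]

theorem MCell.conj_conj (Z : MCell) : Z.conj.conj = Z := by
  funext f; simp only [MCell.conj, conjPt, neg_neg]

theorem MCell.conj_injective : Function.Injective MCell.conj :=
  Function.LeftInverse.injective MCell.conj_conj

/-- the CONJUGATE configuration: both sides replaced by their cellwise conjugates. -/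
def MConfig.conj (C : MConfig) : MConfig := ⟨C.lower.image MCell.conj, C.upper.image MCell.conj⟩

theorem MConfig.conj_lower_card (C : MConfig) : C.conj.lower.card = C.lower.card :=
  Finset.card_image_of_injective _ MCell.conj_injective

theorem MConfig.conj_upper_card (C : MConfig) : C.conj.upper.card = C.upper.card :=
  Finset.card_image_of_injective _ MCell.conj_injective

/-- **transport of the weighted class tensor**: with the multiplicities carried along (`m̄(Z̄) = m(Z)`),
`wch(C̄, m̄)(w) = wch(C, m)(w^{e↔ē})`. -/
theorem MConfig.wch_conj (C : MConfig) (mN mP : MCell → ℤ) (w : CWord) :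
    C.conj.wch (fun Z => mN Z.conj) (fun Z => mP Z.conj) w = C.wch mN mP (swapEW w) := by
  simp only [MConfig.wch, MConfig.conj, Pi.sub_apply, Finset.sum_apply, Pi.smul_apply]
  rw [Finset.sum_image fun a _ b _ h => MCell.conj_injective h,
    Finset.sum_image fun a _ b _ h => MCell.conj_injective h]
  simp only [MCell.conj_conj, MCell.ch_conj]

/-- **(A1) is conjugation-invariant**: a clean weighted design stays clean after `Z ↦ Z̄` on every cell. -/
theorem MConfig.classScreen_conj (C : MConfig) (mN mP : MCell → ℤ) (h : ClassScreen (C.wch mN mP)) :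
    ClassScreen (C.conj.wch (fun Z => mN Z.conj) (fun Z => mP Z.conj)) := by
  have e : C.conj.wch (fun Z => mN Z.conj) (fun Z => mP Z.conj) = fun w => C.wch mN mP (swapEW w) :=
    funext (C.wch_conj mN mP)
  rw [e]; exact classScreen_comp_swapEW h

/-- e-free coefficients (ranks, `ĥ_k`-coordinates, the whole e-free class vector) are UNCHANGED by conjugation. -/
theorem MConfig.wch_conj_of_eFree (C : MConfig) (mN mP : MCell → ℤ) {w : CWord} (hw : EFree w) :
    C.conj.wch (fun Z => mN Z.conj) (fun Z => mP Z.conj) w = C.wch mN mP w := by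
  rw [MConfig.wch_conj, swapEW_of_eFree hw]

/-- **μ is conjugated**: `wch(C̄)(eeee) = star wch(C)(eeee)` — `Im μ ↦ −Im μ`, `Re μ ↦ Re μ`. -/
theorem MConfig.wch_conj_eWord (C : MConfig) (mN mP : MCell → ℤ) :
    C.conj.wch (fun Z => mN Z.conj) (fun Z => mP Z.conj) eWord = star (C.wch mN mP eWord) := by
  rw [MConfig.wch_conj, swapEW_eWord.1, MConfig.wch_ebarWord_eq_star]

end Summit.Ventures.HSemireg.Pad4Tower
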